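import Literature.Topology.FourManifolds.LongAnnulusChart
import Literature.Topology.FourManifolds.ConcordanceStripReplacement
import HarnessLib

/-!
# Reading a long annulus back as a conical concordance

Topic `Literature/Topology/FourManifolds`; step (γ) of the proof programme of the Fox–Milnor fact
`Literature.Topology.FourManifolds.Knot.exists_isConnectedSum_isConcordant` (both concordances
are read in one stereographic chart (`LongAnnulusChart.lean`), straightened, band-summed
statically, and read back). Everything here is proved; no named fact is introduced.

The inverse polar–stereographic chart `unchart (z, r) = r • ψ⁻¹ z` (`LongAnnulusChart.lean`)
turns a long annulus `B : LongAnnulus η` of `ℝ³ × ℝ` (`LongAnnulusShear.lean`) whose end curves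
are the chart images of two knots `K₁`, `K₂`, i.e. `B.k₁ θ = ψ (K₁ (circlePt θ))`,
`B.k₂ θ = ψ (K₂ (circlePt θ))`, into **a conical concordance of width `η` from `K₁` to `K₂`**
(`LongAnnulus.isConicalConcordance_unchart`, with `LongAnnulus.unchartLift`,
`LongAnnulus.unchartAnnulus = StripFrame.descend unchartLift`): the collars become the cones,
the margins give the open shell, injectivity and immersivity pass through `unchart`, which is
injective on `ℝ³ × (0, ∞)` (`unchart_injective_of_pos`) with injective differential there
(`injective_fderiv_unchart`: `Dφ` is injective and orthogonal to `φ`).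

## References

* R. H. Fox, J. W. Milnor, *Singularities of 2-spheres in 4-space and cobordism of knots*, Osaka
  J. Math. 3 (1966), §1. [FoxMilnor1966]

## Design notes

No named facts, no `sorry`; `𝔼 n`, `𝕊 n`, `𝓘₁₁` are local notation as in
`ConcordanceStripReplacement.lean`.
-/

open scoped Manifold Topology ContDiff RealInnerProductSpace
open Function Set Metric Filter

noncomputable section

namespace Literature.Topology.FourManifolds

/-- Local notation: `𝔼 n` is the model Euclidean space `EuclideanSpace ℝ (Fin n)`. -/
local notation "𝔼 " n:arg => EuclideanSpace ℝ (Fin n)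

/-- Local notation: `𝕊 n` is the unit sphere in `EuclideanSpace ℝ (Fin (n + 1))`. -/
local notation "𝕊 " n:arg => (Metric.sphere (0 : EuclideanSpace ℝ (Fin (n + 1))) 1)

/-- Local notation for the model with corners of `𝕊 1 × ℝ`. -/
local notation "𝓘₁₁" => (ModelWithCorners.prod (𝓡 1) 𝓘(ℝ, ℝ))

attribute [local instance] fact_finrank_euclideanSpace_succ

open LongAnnulusChart KnotsInBall StripFrame

/-! ### The inverse chart is an injective immersion on positive radii -/

/-- `unchart` is injective on `ℝ³ × (0, ∞)`. [folklore] -/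
theorem unchart_injective_of_pos {q q' : 𝔼 3 × ℝ} (hq : 0 < q.2) (hq' : 0 < q'.2)
    (h : unchart q = unchart q') : q = q' := by
  have hn : q.2 = q'.2 := by
    have := congrArg (fun y : 𝔼 4 ↦ ‖y‖) h
    simp only [norm_unchart, abs_of_pos hq, abs_of_pos hq'] at this
    exact this
  have hphi : phi q.1 = phi q'.1 := by
    simp only [unchart] at h
    rw [hn] at h
    exact smul_right_injective _ hq'.ne' h
  have h1 : psi.symm q.1 = psi.symm q'.1 := Subtype.ext hphi
  have h2 : q.1 = q'.1 := by
    have := congrArg psi h1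
    rwa [psi_apply_psi_symm, psi_apply_psi_symm] at this
  exact Prod.ext h2 hn

/-- **`unchart` has injective differential at points of positive radius** (`Dφ` is injective
and orthogonal to the unit vector `φ`). [folklore] -/
theorem injective_fderiv_unchart {q : 𝔼 3 × ℝ} (hq : q.2 ≠ 0) : Injective (fderiv ℝ unchart q) := by
  have hφd : HasFDerivAt phi (fderiv ℝ phi q.1) q.1 := ((contDiff_phi.differentiable (by simp)) q.1).hasFDerivAt
  have h1 : HasFDerivAt (fun q : 𝔼 3 × ℝ ↦ phi q.1) ((fderiv ℝ phi q.1).comp (ContinuousLinearMap.fst ℝ (𝔼 3) ℝ)) q :=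
    hφd.comp q hasFDerivAt_fst
  have h2 : HasFDerivAt unchart
      (q.2 • (fderiv ℝ phi q.1).comp (ContinuousLinearMap.fst ℝ (𝔼 3) ℝ) +
        (ContinuousLinearMap.snd ℝ (𝔼 3) ℝ).smulRight (phi q.1)) q :=
    (hasFDerivAt_snd (𝕜 := ℝ) (E := 𝔼 3) (F := ℝ) (p := q)).smul h1
  rw [h2.fderiv]
  refine (injective_iff_map_eq_zero _).2 fun v hv ↦ ?_
  have hv' : q.2 • fderiv ℝ phi q.1 v.1 + v.2 • phi q.1 = 0 := by
    simpa [ContinuousLinearMap.smulRight_apply] using hv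
  -- pair with `φ`
  have h3 : v.2 = 0 := by
    have := congrArg (fun w ↦ ⟪phi q.1, w⟫) hv'
    simp only [inner_add_right, real_inner_smul_right, inner_phi_fderiv, mul_zero, zero_add,
      real_inner_self_eq_norm_sq, norm_phi, one_pow, mul_one, inner_zero_right] at this
    exact this
  rw [h3, zero_smul, add_zero] at hv'
  have h4 : fderiv ℝ phi q.1 v.1 = 0 := by
    rcases smul_eq_zero.1 hv' with h | h
    · exact absurd h hq
    · exact h
  have h5 : v.1 = 0 := (injective_iff_map_eq_zero _).1 (injective_fderiv_phi q.1) _ h4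
  exact Prod.ext h5 h3

namespace LongAnnulus

variable {η : ℝ} (B : LongAnnulus η)

/-! ### The un-charted annulus -/

/-- **The un-charted lift** `unchart ∘ B.F : ℝ × ℝ → ℝ⁴`. [folklore] -/
def unchartLift (q : ℝ × ℝ) : 𝔼 4 := unchart (B.F q)

/-- The un-charted lift is `C^∞`. [folklore] -/
theorem contDiff_unchartLift : ContDiff ℝ ∞ B.unchartLift := contDiff_unchart.comp B.contDiff_F

/-- The un-charted lift is `1`-periodic. [folklore] -/
theorem unchartLift_add_one (θ t : ℝ) : B.unchartLift (θ + 1, t) = B.unchartLift (θ, t) := by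
  simp [unchartLift, B.F_add_one]

/-- The radius of the un-charted lift is the level. [folklore] -/
theorem norm_unchartLift (q : ℝ × ℝ) : ‖B.unchartLift q‖ = |(B.F q).2| := norm_unchart _

/-- In the lower collar the un-charted lift is the cone over `ψ⁻¹ ∘ k₁`. [folklore] -/
theorem unchartLift_of_le {θ t : ℝ} (ht : t ≤ 1 + η) : B.unchartLift (θ, t) = t • phi (B.k₁ θ) := by
  simp [unchartLift, B.collar₁ θ t ht, unchart]

/-- In the upper collar the un-charted lift is the cone over `ψ⁻¹ ∘ k₂`. [folklore] -/
theorem unchartLift_of_ge {θ t : ℝ} (ht : 2 - η ≤ t) : B.unchartLift (θ, t) = t • phi (B.k₂ θ) := by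
  simp [unchartLift, B.collar₂ θ t ht, unchart]

/-- **The un-charted annulus** on `𝕊¹ × ℝ`. [folklore] -/
def unchartAnnulus : (𝕊 1) × ℝ → 𝔼 4 := descend B.unchartLift

/-- Values over angles. [folklore] -/
theorem unchartAnnulus_circlePt (u t : ℝ) : B.unchartAnnulus (circlePt u, t) = B.unchartLift (u, t) :=
  descend_circlePt B.unchartLift_add_one u t

/-- The level of a long annulus is positive on `[1/2, ∞)`... more precisely at every parameter
`t > 0`: `t` in the collars, in `(1, 2)` in the middle. [folklore] -/
theorem snd_F_pos {θ t : ℝ} (ht : 0 < t) : 0 < (B.F (θ, t)).2 := by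
  have hη := B.η_pos
  rcases le_or_gt t (1 + η) with h1 | h1
  · rw [B.snd_F_of_le h1]; exact ht
  rcases le_or_gt (2 - η) t with h2 | h2
  · rw [B.snd_F_of_ge h2]; linarith
  · have := B.snd_F_mem_Ioo θ (s := t) ⟨by linarith, by linarith⟩
    linarith [this.1]

/-- **A long annulus whose end curves are chart images of knots un-charts to a conical
concordance** of the same width between these knots. [folklore] -/
theorem isConicalConcordance_unchart {K₁ K₂ : Knot} (hK₁ : ∀ x, K₁ x ≠ southPole)
    (hK₂ : ∀ x, K₂ x ≠ southPole) (hk₁ : ∀ θ, B.k₁ θ = psi (K₁ (circlePt θ)))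
    (hk₂ : ∀ θ, B.k₂ θ = psi (K₂ (circlePt θ))) :
    Knot.IsConicalConcordance K₁ K₂ B.unchartAnnulus η := by
  have hη := B.η_pos
  have hη4 := B.η_le
  have hGs := B.contDiff_unchartLift
  have hper := B.unchartLift_add_one
  have hval := B.unchartAnnulus_circlePt
  have hphi₁ : ∀ θ, phi (B.k₁ θ) = ((K₁ (circlePt θ) : 𝕊 3) : 𝔼 4) := fun θ ↦ by
    rw [hk₁, phi, psi_symm_apply_psi (hK₁ _)]
  have hphi₂ : ∀ θ, phi (B.k₂ θ) = ((K₂ (circlePt θ) : 𝕊 3) : 𝔼 4) := fun θ ↦ by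
    rw [hk₂, phi, psi_symm_apply_psi (hK₂ _)]
  have hcone₁ : ∀ (x : 𝕊 1) (t : ℝ), t ≤ 1 + η → B.unchartAnnulus (x, t) = t • ((K₁ x : 𝕊 3) : 𝔼 4) := by
    intro x t ht
    rw [← circlePt_angA x, hval, B.unchartLift_of_le ht, hphi₁, circlePt_angA]
  have hcone₂ : ∀ (x : 𝕊 1) (t : ℝ), 2 - η ≤ t → B.unchartAnnulus (x, t) = t • ((K₂ x : 𝕊 3) : 𝔼 4) := by
    intro x t ht
    rw [← circlePt_angA x, hval, B.unchartLift_of_ge ht, hphi₂, circlePt_angA]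
  refine
    { isConcordance := ⟨contMDiff_descend hGs hper, ?_, ?_, ?_, ?_, ?_, ?_⟩
      δ_pos := hη
      δ_le := hη4
      cone₁ := hcone₁
      cone₂ := hcone₂ }
  · -- injectivity on the annulus
    rintro ⟨x, t⟩ ⟨-, ht⟩ ⟨x', t'⟩ ⟨-, ht'⟩ he
    change B.unchartAnnulus (x, t) = B.unchartAnnulus (x', t') at he
    rw [← circlePt_angA x, ← circlePt_angA x', hval, hval, unchartLift, unchartLift] at he
    have hinj := unchart_injective_of_pos (B.snd_F_pos (by linarith [ht.1])) (B.snd_F_pos (by linarith [ht'.1])) he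
    obtain ⟨htt, k, hk⟩ := B.inj _ _ ht ht' hinj
    simp only at htt hk
    have hx : x' = x := by
      rw [← circlePt_angA x', hk, circlePt_add_int, circlePt_angA]
    subst htt
    rw [hx]
  · -- immersion on the annulus
    rintro ⟨x, t⟩ ⟨-, ht⟩
    refine mfderiv_descend_injective hGs hper fun u _ ↦ ?_
    have hcomp : fderiv ℝ B.unchartLift (u, t) = (fderiv ℝ unchart (B.F (u, t))).comp (fderiv ℝ B.F (u, t)) :=
      fderiv_comp _ ((contDiff_unchart.differentiable (by simp)) _) ((B.contDiff_F.differentiable (by simp)) _)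
    rw [hcomp]
    exact (injective_fderiv_unchart (B.snd_F_pos (by linarith [ht.1])).ne').comp (B.injective_fderiv _ ht)
  · -- the open annulus goes into the open shell
    intro x t ht
    rw [← circlePt_angA x, hval, B.norm_unchartLift]
    have hm := B.margin_Ioo 0 ⟨le_rfl, hη.le⟩ (angA x) t (by simpa using ht)
    simp only [add_zero, sub_zero] at hm
    rw [abs_of_pos (by linarith [hm.1])]
    exact hm
  · -- neatness: the ends are cones
    intro x
    constructor
    · have hev : (fun s ↦ ‖B.unchartAnnulus (x, s)‖ ^ 2) =ᶠ[𝓝 1] fun s ↦ s ^ 2 := by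
        filter_upwards [Ioo_mem_nhds (by norm_num : (0 : ℝ) < 1) (by linarith : (1 : ℝ) < 1 + η)] with s hs
        rw [hcone₁ x s hs.2.le, norm_smul, norm_eq_of_mem_sphere, mul_one, Real.norm_eq_abs, sq_abs]
      rw [hev.deriv_eq]
      norm_num
    · have hev : (fun s ↦ ‖B.unchartAnnulus (x, s)‖ ^ 2) =ᶠ[𝓝 2] fun s ↦ s ^ 2 := by
        filter_upwards [Ioi_mem_nhds (by linarith : (2 : ℝ) - η < 2)] with s hs
        rw [hcone₂ x s (le_of_lt hs), norm_smul, norm_eq_of_mem_sphere, mul_one, Real.norm_eq_abs, sq_abs]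
      rw [hev.deriv_eq]
      norm_num
  · intro x
    rw [hcone₁ x 1 (by linarith), one_smul]
  · intro x
    exact hcone₂ x 2 (by linarith)

end LongAnnulus

end Literature.Topology.FourManifolds
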